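import Literature.Analysis.FunctionSpaces.GagliardoNirenbergSobolev
import HarnessLib

/-!
# The Gagliardo–Nirenberg–Sobolev inequality on coordinate-lower sets

`Literature.Analysis.FunctionSpaces.GagliardoNirenbergSobolev` proves the
Gagliardo–Nirenberg–Sobolev inequality `‖u‖_{L^{p*}(E)} ≤ C ‖Du‖_{L^p(E)}` (`1 ≤ p < n = dim E`, `1/p* = 1/p - 1/n`) for
`C¹` functions `u : E → F` with compact support (`Literature.Analysis.FunctionSpaces.eLpNorm_le_mul_eLpNorm_fderiv_of_eq`). This
file proves the same inequality with both norms taken over a measurable subset `U ⊆ E` only,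
`‖u‖_{L^{p*}(U)} ≤ C ‖Du‖_{L^p(U)}` for **all** `u ∈ C¹_c(E; F)` (no vanishing on `∂U`), provided
`U` is a *lower set in suitable linear coordinates*: for some linear isomorphism
`e : E ≃L[ℝ] ℝⁿ`, moving from a point of `U` in the direction `-e⁻¹(eᵢ)` of any coordinate axis
never leaves `U` (`Literature.Analysis.FunctionSpaces.exists_eLpNorm_restrict_le_mul_eLpNorm_restrict_fderiv`). Examples:
half-spaces, and — the case this file is written for — strict epigraphs `{γ(y') < yₙ}` of
Lipschitz functions, in coordinates whose axes all lie in the cone `{K |v'| ≤ -vₙ}` (see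
`Literature.Analysis.FunctionSpaces.SobolevTraceEmbeddingProofs`, where the Sobolev embedding
`W^{1,p}(Ω) ⊆ L^{p*}(Ω)` on bounded Lipschitz domains is deduced).

This is the device of R. A. Adams, *Sobolev Spaces* (1975), Lemma 5.10 (the case `m = 1` of the
Sobolev imbedding theorem 5.4, Part I, Case A for bounded domains with the cone property;
= Adams–Fournier, 2nd ed. (2003), Thm. 4.12, Part I, Case C): Gagliardo's proof of Sobolev's
inequality (Adams, 5.11, (21)) only integrates `d/dt |u|^γ` along *one-sided* coordinate
half-lines `x + t eᵢ` issuing from `x`, so it applies verbatim on a region which contains, with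
each of its points, these half-lines ("`w_i(x)` contains a segment ... with one endpoint at `x`",
loc. cit.), the integrals then extending over the region only.

## Main results

* `Literature.Analysis.FunctionSpaces.indicator_enorm_rpow_le_lintegral_indicator_update`: the one-sided line estimate on
  `ℝⁿ = ι → ℝ`: for `γ ≥ 1`, a coordinate-lower set `V` and `x ∈ V`,
  `‖u x‖^γ ≤ ∫_{t ≤ xᵢ} γ ‖u‖^{γ-1} ‖Du‖ (update x i t) dt`, the half-line staying in `V`.
* `Literature.Analysis.FunctionSpaces.lintegral_indicator_rpow_pow_le`: `∫_V (‖u‖^γ)^{n'} ≤ (∫_V γ ‖u‖^{γ-1} ‖Du‖)^{n'}`,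
  `n' = n/(n-1)`, by the grid-lines lemma (`Literature.Analysis.FunctionSpaces.lintegral_rpow_le_of_le_lintegral_update`).
* `Literature.Analysis.FunctionSpaces.setLIntegral_rpow_pow_le_of_equiv`: transfer to a finite-dimensional `E` with an additive
  Haar measure along any `e : E ≃L[ℝ] (ι → ℝ)` (Haar uniqueness), for `U ⊆ E` lower in the
  `e`-coordinates.
* `Literature.Analysis.FunctionSpaces.exists_eLpNorm_restrict_le_mul_eLpNorm_restrict_fderiv`: the inequality
  `‖u‖_{L^{p*}(μ|U)} ≤ C ‖Du‖_{L^p(μ|U)}` for `1 ≤ p < n`, `u ∈ C¹_c(E; F)`, `F` any real normed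
  space, with `C` depending on `E`, `μ`, `p`, `e` only (Hölder step as in Adams, 5.10 / Evans,
  *PDE*, §5.6.1, Theorem 1).

## References

* R. A. Adams, *Sobolev Spaces*, Academic Press (1975), Lemma 5.10 and Remark 5.11.
* R. A. Adams, J. J. F. Fournier, *Sobolev Spaces*, 2nd ed. (2003), Thm. 4.12.
* L. C. Evans, *Partial Differential Equations*, 2nd ed. (2010), §5.6.1, Theorem 1.
-/

noncomputable section

open scoped ENNReal NNReal
open Set Function Finset MeasureTheory Measure Filter Module

namespace Literature.Analysis.FunctionSpaces

variable {ι : Type*} {F : Type*} [NormedAddCommGroup F] [NormedSpace ℝ F]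

local prefix:max "#" => Fintype.card

/-! ### The one-sided line estimate on coordinate-lower sets of `ℝⁿ` -/

/-- On a set `V ⊆ ℝⁿ` which is *lower in each coordinate* (`x ∈ V`, `t ≤ xᵢ` implies
`update x i t ∈ V`), the integral of `G` over the half-line `{update x i t | t ≤ xᵢ}` through a
point `x ∈ V` is dominated by the integral of `𝟙_V G` over the whole line. [folklore] -/
theorem setLIntegral_Iic_update_le_lintegral_indicator [DecidableEq ι] {V : Set (ι → ℝ)}
    (hV : ∀ x ∈ V, ∀ i, ∀ t ≤ x i, update x i t ∈ V) {x : ι → ℝ} (hx : x ∈ V) (i : ι)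
    (G : (ι → ℝ) → ℝ≥0∞) :
    ∫⁻ t in Iic (x i), G (update x i t) ≤ ∫⁻ t, V.indicator G (update x i t) :=
  calc ∫⁻ t in Iic (x i), G (update x i t) = ∫⁻ t in Iic (x i), V.indicator G (update x i t) :=
        setLIntegral_congr_fun measurableSet_Iic fun t ht =>
          (indicator_of_mem (hV x hx i t ht) G).symm
    _ ≤ ∫⁻ t, V.indicator G (update x i t) := lintegral_mono' Measure.restrict_le_self le_rfl

/-- **One-sided line estimate** (Adams, *Sobolev Spaces* (1975), proof of Lemma 5.10, (19)–(20),
and Remark 5.11: `sup |u|^γ ≤ γ ∫ |u|^{γ-1} |Dᵢu| dxᵢ` along a coordinate half-line contained in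
the region). Let `V ⊆ ℝⁿ` be lower in each coordinate, `u ∈ C¹_c(ℝⁿ; F)` with `F` any real normed
space and `γ ≥ 1`. Then for every `x` and `i`,
`𝟙_V(x) ‖u x‖^γ ≤ ∫ 𝟙_V γ ‖u‖^{γ-1} ‖Du‖ (update x i t) dt`: for `x ∈ V` the fundamental theorem
of calculus on `(-∞, xᵢ]` (where the line stays in `V`) applied, for `γ > 1`, to the real `C¹`
function `|ℓ ∘ u|^γ` with `ℓ` a norming functional at `u x` (as in
`Literature.Analysis.FunctionSpaces.enorm_rpow_le_lintegral_update`), and for `γ = 1` to `u` itself. [cite: Adams1975, Lemma 5.10 (proof, (19)–(20)) and Remark 5.11] -/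
theorem indicator_enorm_rpow_le_lintegral_indicator_update [Fintype ι] [DecidableEq ι]
    {u : (ι → ℝ) → F} (hu : ContDiff ℝ 1 u) (h2u : HasCompactSupport u) {γ : ℝ≥0} (hγ : 1 ≤ γ)
    {V : Set (ι → ℝ)} (hV : ∀ x ∈ V, ∀ i, ∀ t ≤ x i, update x i t ∈ V) (x : ι → ℝ) (i : ι) :
    V.indicator (fun y => ‖u y‖ₑ ^ (γ : ℝ)) x ≤
      ∫⁻ t, V.indicator (fun y => γ * ‖u y‖ₑ ^ ((γ : ℝ) - 1) * ‖fderiv ℝ u y‖ₑ) (update x i t) := by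
  by_cases hx : x ∈ V
  swap
  · simp [hx]
  rw [indicator_of_mem hx]
  set G : (ι → ℝ) → ℝ≥0∞ := fun y => γ * ‖u y‖ₑ ^ ((γ : ℝ) - 1) * ‖fderiv ℝ u y‖ₑ with hG
  have hud : Differentiable ℝ u := hu.differentiable one_ne_zero
  rcases hγ.eq_or_lt with rfl | hγ1
  · -- the case `γ = 1`: fundamental theorem of calculus for `u` itself
    simp only [NNReal.coe_one, ENNReal.rpow_one]
    calc ‖u x‖ₑ
      _ ≤ ∫⁻ t in Iic (x i), ‖deriv (u ∘ update x i) t‖ₑ := by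
          apply le_trans (by simp) (HasCompactSupport.enorm_le_lintegral_Ici_deriv _ _ _)
          · exact hu.comp (by convert! contDiff_update 1 x i)
          · exact h2u.comp_isClosedEmbedding (isClosedEmbedding_update x i)
      _ ≤ ∫⁻ t in Iic (x i), G (update x i t) := by
          refine lintegral_mono fun t => ?_
          calc ‖deriv (u ∘ update x i) t‖ₑ
              = ‖fderiv ℝ u (update x i t) (deriv (update x i) t)‖ₑ := by
                rw [fderiv_comp_deriv _ (hud _) (hasDerivAt_update x i t).differentiableAt]
            _ ≤ ‖fderiv ℝ u (update x i t)‖ₑ * ‖deriv (update x i) t‖ₑ :=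
                ContinuousLinearMap.le_opENorm _ _
            _ ≤ ‖fderiv ℝ u (update x i t)‖ₑ := by simp [deriv_update, Pi.enorm_single]
            _ = G (update x i t) := by simp [hG]
      _ ≤ ∫⁻ t, V.indicator G (update x i t) :=
          setLIntegral_Iic_update_le_lintegral_indicator hV hx i G
  -- the case `γ > 1`: norming functional and `|ℓ ∘ u| ^ γ`
  have hγ' : 1 < (γ : ℝ) := by exact_mod_cast hγ1
  have hγ0 : (γ : ℝ) ≠ 0 := (zero_lt_one.trans hγ').ne'
  obtain ⟨ℓ, hℓ, hℓx⟩ := exists_dual_vector'' ℝ (u x)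
  set w : (ι → ℝ) → ℝ := fun y => ‖ℓ (u y)‖ ^ (γ : ℝ) with hw_def
  have hℓu : ContDiff ℝ 1 fun y => ℓ (u y) := ℓ.contDiff.comp hu
  have hw : ContDiff ℝ 1 w := hℓu.norm_rpow hγ'
  have h2w : HasCompactSupport w := by
    refine h2u.comp_left (g := fun z : F => ‖ℓ z‖ ^ (γ : ℝ)) ?_
    simp [Real.zero_rpow hγ0]
  have hℓud : Differentiable ℝ fun y => ℓ (u y) := hℓu.differentiable one_ne_zero
  -- pointwise bound on the derivative of `w`
  have hDw : ∀ y, ‖fderiv ℝ w y‖ₑ ≤ G y := by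
    intro y
    have h1 := enorm_fderiv_norm_rpow_le (f := fun y => ℓ (u y)) hℓud (x := y) hγ1
    refine h1.trans ?_
    have hγ1' : 0 ≤ (γ : ℝ) - 1 := sub_nonneg.2 hγ'.le
    have hℓ1 : ‖(ℓ : F →L[ℝ] ℝ)‖ₑ ≤ 1 := by
      rw [enorm_eq_nnnorm, ← ENNReal.coe_one, ENNReal.coe_le_coe]
      exact hℓ
    simp only [hG]
    gcongr
    · calc ‖ℓ (u y)‖ₑ ≤ ‖(ℓ : F →L[ℝ] ℝ)‖ₑ * ‖u y‖ₑ := ℓ.le_opENorm (u y)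
          _ ≤ 1 * ‖u y‖ₑ := by gcongr
          _ = ‖u y‖ₑ := one_mul _
    · calc ‖fderiv ℝ (fun y => ℓ (u y)) y‖ₑ = ‖(ℓ : F →L[ℝ] ℝ).comp (fderiv ℝ u y)‖ₑ := by
              rw [show (fun y => ℓ (u y)) = ℓ ∘ u from rfl,
                fderiv_comp y ℓ.differentiableAt (hud y), ℓ.fderiv]
          _ ≤ ‖(ℓ : F →L[ℝ] ℝ)‖ₑ * ‖fderiv ℝ u y‖ₑ := ContinuousLinearMap.opENorm_comp_le _ _
          _ ≤ 1 * ‖fderiv ℝ u y‖ₑ := by gcongr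
          _ = ‖fderiv ℝ u y‖ₑ := one_mul _
  -- `‖u x‖ ^ γ = w x`
  have hwx : ‖u x‖ₑ ^ (γ : ℝ) = ‖w x‖ₑ := by
    simp only [hw_def, hℓx]
    rw [Real.enorm_rpow_of_nonneg (by positivity) (by positivity)]
    simp [enorm, nnnorm_norm]
  rw [hwx]
  calc ‖w x‖ₑ
    _ ≤ ∫⁻ t in Iic (x i), ‖deriv (w ∘ update x i) t‖ₑ := by
        apply le_trans (by simp) (HasCompactSupport.enorm_le_lintegral_Ici_deriv _ _ _)
        · exact hw.comp (by convert! contDiff_update 1 x i)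
        · exact h2w.comp_isClosedEmbedding (isClosedEmbedding_update x i)
    _ ≤ ∫⁻ t in Iic (x i), G (update x i t) := by
        refine lintegral_mono fun t => ?_
        calc ‖deriv (w ∘ update x i) t‖ₑ
            = ‖fderiv ℝ w (update x i t) (deriv (update x i) t)‖ₑ := by
              rw [fderiv_comp_deriv _ (hw.differentiable one_ne_zero).differentiableAt
                (hasDerivAt_update x i t).differentiableAt]
          _ ≤ ‖fderiv ℝ w (update x i t)‖ₑ * ‖deriv (update x i) t‖ₑ :=
              ContinuousLinearMap.le_opENorm _ _
          _ ≤ ‖fderiv ℝ w (update x i t)‖ₑ := by simp [deriv_update, Pi.enorm_single]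
          _ ≤ G (update x i t) := hDw _
    _ ≤ ∫⁻ t, V.indicator G (update x i t) :=
        setLIntegral_Iic_update_le_lintegral_indicator hV hx i G

/-- Gagliardo–Nirenberg–Sobolev estimate for a power of the norm **on a coordinate-lower set**
`V ⊆ ℝⁿ` (`n = #ι ≥ 2`, `p = n / (n - 1)`): for `u ∈ C¹_c(ℝⁿ; F)` and `γ ≥ 1`,
`∫_V (‖u‖ ^ γ) ^ p ≤ (∫_V γ ‖u‖ ^ (γ - 1) ‖Du‖) ^ p`, both integrals over `V` only and no
condition on `u` at the boundary of `V` (Adams, *Sobolev Spaces* (1975), proof of Lemma 5.10: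
the one-sided line estimates (20) fed into Gagliardo's combinatorial Lemma 5.9, here in the form
`Literature.Analysis.FunctionSpaces.lintegral_rpow_le_of_le_lintegral_update` with `w = 𝟙_V ‖u‖^γ`,
`h = 𝟙_V γ ‖u‖^{γ-1} ‖Du‖`). Stated with indicators. [cite: Adams1975, Lemma 5.10 (proof)] -/
theorem lintegral_indicator_rpow_pow_le [Fintype ι] [DecidableEq ι] {p : ℝ}
    (hp : Real.HolderConjugate #ι p) {u : (ι → ℝ) → F} (hu : ContDiff ℝ 1 u)
    (h2u : HasCompactSupport u) {γ : ℝ≥0} (hγ : 1 ≤ γ) {V : Set (ι → ℝ)} (hVm : MeasurableSet V)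
    (hV : ∀ x ∈ V, ∀ i, ∀ t ≤ x i, update x i t ∈ V) :
    ∫⁻ x, V.indicator (fun y => ‖u y‖ₑ ^ (γ : ℝ)) x ^ p ≤
      (∫⁻ x, V.indicator (fun y => γ * ‖u y‖ₑ ^ ((γ : ℝ) - 1) * ‖fderiv ℝ u y‖ₑ) x) ^ p := by
  borelize F
  have h7u := hu.continuous
  have h8u := hu.continuous_fderiv one_ne_zero
  refine lintegral_rpow_le_of_le_lintegral_update hp ?_
    (fun x i => indicator_enorm_rpow_le_lintegral_indicator_update hu h2u hγ hV x i)
  exact Measurable.indicator (by fun_prop) hVm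

/-! ### Transfer to a finite-dimensional space with a Haar measure -/

variable {E : Type*} [NormedAddCommGroup E] [NormedSpace ℝ E] [MeasurableSpace E] [BorelSpace E]
  [FiniteDimensional ℝ E] (μ : Measure E) [IsAddHaarMeasure μ]

/-- `update y i t = y + (t - yᵢ) eᵢ` on `ι → ℝ`. [folklore] -/
theorem update_eq_add_sub_smul_single [DecidableEq ι] (y : ι → ℝ) (i : ι) (t : ℝ) :
    update y i t = y + (t - y i) • (Pi.single i (1 : ℝ) : ι → ℝ) := by
  ext j
  rcases eq_or_ne j i with rfl | hj
  · simp
  · simp [hj]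

/-- Gagliardo–Nirenberg–Sobolev estimate for a power of the norm on a set `U ⊆ E` which is
**lower in the coordinates of a linear isomorphism** `e : E ≃L[ℝ] (ι → ℝ)` (`x ∈ U`, `t ≤ 0`
imply `x + t e⁻¹(eᵢ) ∈ U`): for `E` of dimension `n ≥ 2` with an additive Haar measure `μ`,
`p = n / (n - 1)`, `u ∈ C¹_c(E; F)` and `γ ≥ 1`,
`∫_U (‖u‖ ^ γ) ^ p dμ ≤ C (∫_U γ ‖u‖ ^ (γ - 1) ‖Du‖ dμ) ^ p` with
`C = c ‖e⁻¹‖ ^ p / c ^ p`, `c` the Haar scalar factor of `μ` against the image of Lebesgue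
measure under `e⁻¹` (transfer along `e` exactly as in Mathlib's
`MeasureTheory.lintegral_pow_le_pow_lintegral_fderiv`, from `Literature.Analysis.FunctionSpaces.lintegral_indicator_rpow_pow_le`
on `V = e(U)`). (Adams, *Sobolev Spaces* (1975), Lemma 5.10, after "a suitable nonsingular linear
transformation".) [cite: Adams1975, Lemma 5.10 (proof)] -/
theorem setLIntegral_rpow_pow_le_of_equiv [Fintype ι] [DecidableEq ι] (e : E ≃L[ℝ] (ι → ℝ))
    {U : Set E}
    (hUm : MeasurableSet U)
    (hU : ∀ x ∈ U, ∀ i, ∀ t ≤ (0 : ℝ), x + t • e.symm (Pi.single i (1 : ℝ)) ∈ U)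
    {u : E → F} (hu : ContDiff ℝ 1 u) (h2u : HasCompactSupport u)
    {p : ℝ} (hp : Real.HolderConjugate (finrank ℝ E) p) {γ : ℝ≥0} (hγ : 1 ≤ γ) :
    ∫⁻ x in U, (‖u x‖ₑ ^ (γ : ℝ)) ^ p ∂μ ≤
      ((addHaarScalarFactor μ ((volume : Measure (ι → ℝ)).map e.symm) *
          ‖(e.symm : (ι → ℝ) →L[ℝ] E)‖₊ ^ p) *
          ((addHaarScalarFactor μ ((volume : Measure (ι → ℝ)).map e.symm)) ^ p)⁻¹ : ℝ≥0) *
        (∫⁻ x in U, γ * ‖u x‖ₑ ^ ((γ : ℝ) - 1) * ‖fderiv ℝ u x‖ₑ ∂μ) ^ p := by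
  have hιcard : #ι = finrank ℝ E := by
    rw [e.toLinearEquiv.finrank_eq, finrank_fintype_fun_eq_card]
  have hp : Real.HolderConjugate #ι p := by rwa [hιcard]
  have h0p : 0 ≤ p := hp.symm.nonneg
  have h0p' : 0 < p := hp.symm.pos
  set c := addHaarScalarFactor μ ((volume : Measure (ι → ℝ)).map e.symm) with hc_def
  have hc : 0 < c := addHaarScalarFactor_pos_of_isAddHaarMeasure ..
  have h2c : μ = c • ((volume : Measure (ι → ℝ)).map e.symm) := isAddLeftInvariant_eq_smul ..
  have h3c : (c : ℝ≥0∞) ≠ 0 := by simp_rw [ne_eq, ENNReal.coe_eq_zero, hc.ne', not_false_eq_true]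
  set C : ℝ≥0 := (c * ‖(e.symm : (ι → ℝ) →L[ℝ] E)‖₊ ^ p) * (c ^ p)⁻¹ with hC_def
  have hC : C * c ^ p = c * ‖(e.symm : (ι → ℝ) →L[ℝ] E)‖₊ ^ p := by
    rw [hC_def, inv_mul_cancel_right₀ (NNReal.rpow_pos hc).ne']
  -- pass to indicator integrals over the whole space
  rw [← lintegral_indicator hUm, ← lintegral_indicator hUm]
  have hind : ∀ x, U.indicator (fun x => (‖u x‖ₑ ^ (γ : ℝ)) ^ p) x =
      U.indicator (fun x => ‖u x‖ₑ ^ (γ : ℝ)) x ^ p := by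
    intro x
    by_cases hx : x ∈ U
    · simp [hx]
    · simp [hx, ENNReal.zero_rpow_of_pos h0p']
  simp only [hind]
  simp only [h2c, ENNReal.smul_def, lintegral_smul_measure, smul_eq_mul]
  -- the transferred data on `ι → ℝ`
  let v : (ι → ℝ) → F := u ∘ e.symm
  have hv : ContDiff ℝ 1 v := hu.comp e.symm.contDiff
  have h2v : HasCompactSupport v := h2u.comp_homeomorph e.symm.toHomeomorph
  set V : Set (ι → ℝ) := e.symm ⁻¹' U with hV_def
  have hVm : MeasurableSet V := e.symm.continuous.measurable hUm
  have hVl : ∀ y ∈ V, ∀ i, ∀ t ≤ y i, update y i t ∈ V := by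
    intro y hy i t ht
    change e.symm (update y i t) ∈ U
    rw [update_eq_add_sub_smul_single, map_add, map_smul]
    exact hU (e.symm y) hy i (t - y i) (sub_nonpos.2 ht)
  have h7u := hu.continuous
  have h8u := hu.continuous_fderiv one_ne_zero
  borelize F
  -- the integrands, as functions on `E`
  set W : E → ℝ≥0∞ := fun x => ‖u x‖ₑ ^ (γ : ℝ) with hW
  set G : E → ℝ≥0∞ := fun x => γ * ‖u x‖ₑ ^ ((γ : ℝ) - 1) * ‖fderiv ℝ u x‖ₑ with hG
  have hWm : Measurable W := by rw [hW]; fun_prop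
  have hGm : Measurable G := by rw [hG]; fun_prop
  have hWv : ∀ y, (U.indicator W) (e.symm y) = V.indicator (fun y => ‖v y‖ₑ ^ (γ : ℝ)) y := by
    intro y
    rw [hV_def, ← indicator_comp_right]
    rfl
  have hGv : ∀ y, V.indicator (fun y => γ * ‖v y‖ₑ ^ ((γ : ℝ) - 1) * ‖fderiv ℝ v y‖ₑ) y ≤
      V.indicator (fun y => G (e.symm y) * ‖(e.symm : (ι → ℝ) →L[ℝ] E)‖ₑ) y := by
    intro y
    by_cases hy : y ∈ V
    swap
    · simp [hy]
    rw [indicator_of_mem hy, indicator_of_mem hy]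
    have hDv : fderiv ℝ v y = (fderiv ℝ u (e.symm y)).comp (e.symm : (ι → ℝ) →L[ℝ] E) := by
      rw [show v = u ∘ e.symm from rfl, fderiv_comp _ (hu.differentiable one_ne_zero _)
        e.symm.differentiableAt, e.symm.fderiv]
    rw [hDv]
    simp only [hG, mul_assoc]
    change (γ : ℝ≥0∞) * (‖u (e.symm y)‖ₑ ^ ((γ : ℝ) - 1) * _) ≤ _
    gcongr
    apply ContinuousLinearMap.opENorm_comp_le
  have :=
  calc ∫⁻ x, U.indicator W x ^ p ∂(volume : Measure (ι → ℝ)).map e.symm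
      = ∫⁻ y, V.indicator (fun y => ‖v y‖ₑ ^ (γ : ℝ)) y ^ p := by
        rw [lintegral_map ((hWm.indicator hUm).pow_const _) e.symm.continuous.measurable]
        simp only [hWv]
    _ ≤ (∫⁻ y, V.indicator (fun y => γ * ‖v y‖ₑ ^ ((γ : ℝ) - 1) * ‖fderiv ℝ v y‖ₑ) y) ^ p :=
        lintegral_indicator_rpow_pow_le hp hv h2v hγ hVm hVl
    _ ≤ (∫⁻ y, V.indicator (fun y => G (e.symm y) * ‖(e.symm : (ι → ℝ) →L[ℝ] E)‖ₑ) y) ^ p := by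
        gcongr ?_ ^ p
        exact lintegral_mono hGv
    _ = (∫⁻ y, (U.indicator G) (e.symm y) * ‖(e.symm : (ι → ℝ) →L[ℝ] E)‖ₑ) ^ p := by
        congr! 3 with y
        rw [hV_def, ← indicator_comp_right, indicator_mul_const]
        rfl
    _ = (‖(e.symm : (ι → ℝ) →L[ℝ] E)‖ₑ * ∫⁻ y, (U.indicator G) (e.symm y)) ^ p := by
        rw [lintegral_mul_const, mul_comm]
        exact (hGm.indicator hUm).comp e.symm.continuous.measurable
    _ = (‖(e.symm : (ι → ℝ) →L[ℝ] E)‖₊ ^ p : ℝ≥0) * (∫⁻ y, (U.indicator G) (e.symm y)) ^ p := by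
        rw [ENNReal.mul_rpow_of_nonneg _ _ h0p, enorm_eq_nnnorm, ← ENNReal.coe_rpow_of_nonneg _ h0p]
    _ = (‖(e.symm : (ι → ℝ) →L[ℝ] E)‖₊ ^ p : ℝ≥0)
        * (∫⁻ x, U.indicator G x ∂(volume : Measure (ι → ℝ)).map e.symm) ^ p := by
        congr
        rw [lintegral_map (hGm.indicator hUm) e.symm.continuous.measurable]
  rw [← ENNReal.mul_le_mul_iff_right h3c ENNReal.coe_ne_top, ← mul_assoc, ← ENNReal.coe_mul, ← hC,
    ENNReal.coe_mul] at this
  rw [ENNReal.mul_rpow_of_nonneg _ _ h0p, ← mul_assoc, ← ENNReal.coe_rpow_of_ne_zero hc.ne']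
  exact this

/-- **The Gagliardo–Nirenberg–Sobolev inequality on a coordinate-lower set.** Let `E` be a real
normed space of finite dimension `n > 0` with an additive Haar measure `μ`, `e : E ≃L[ℝ] (ι → ℝ)`
a linear isomorphism and `U ⊆ E` a measurable set such that `x ∈ U`, `t ≤ 0` imply
`x + t e⁻¹(eᵢ) ∈ U` for every coordinate vector `eᵢ`. Let `1 ≤ p` and `p'⁻¹ = p⁻¹ - n⁻¹`
(`p`, `p'` in `ℝ≥0`; for `p ≥ n` this forces `p' = 0` and the statement is trivial). Then there
is `C` (depending on `E`, `μ`, `e`, `p` only) with `‖u‖_{L^{p'}(μ|U)} ≤ C ‖Du‖_{L^p(μ|U)}` for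
**every** `u ∈ C¹_c(E; F)`, `F` any real normed space — no vanishing of `u` on `∂U` is required.
This is R. A. Adams, *Sobolev Spaces* (1975), Lemma 5.10 (the estimate (18)
`‖u‖_{0,q,Ω} ≤ K ‖u‖_{1,p,Ω}`, `q = np/(n-p)`, for regions containing a coordinate segment from
each point; here half-lines and compactly supported `u`, so that, as in Remark 5.11 / Sobolev's
inequality (21), no `‖u‖_{0,p}` term arises) = Adams–Fournier (2003), Thm. 4.12, Part I, Case C,
`m = 1`; the Hölder bookkeeping (`γ = p(n-1)/(n-p)`, cancellation of `‖u‖_{0,q}^{q/p'}`) is that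
of `Literature.Analysis.FunctionSpaces.eLpNorm_le_mul_eLpNorm_fderiv_of_eq` with `μ|U` in place of `μ`. [cite: Adams1975, Lemma 5.10 and Remark 5.11] [cite: AdamsFournier2003, Thm. 4.12 Part I Case C (m = 1)] -/
theorem exists_eLpNorm_restrict_le_mul_eLpNorm_restrict_fderiv [Fintype ι] [DecidableEq ι]
    (e : E ≃L[ℝ] (ι → ℝ)) {U : Set E} (hUm : MeasurableSet U)
    (hU : ∀ x ∈ U, ∀ i, ∀ t ≤ (0 : ℝ), x + t • e.symm (Pi.single i (1 : ℝ)) ∈ U)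
    {p p' : ℝ≥0} (hp : 1 ≤ p) (hn : 0 < finrank ℝ E)
    (hp' : (p' : ℝ)⁻¹ = p⁻¹ - (finrank ℝ E : ℝ)⁻¹) :
    ∃ C : ℝ≥0, ∀ u : E → F, ContDiff ℝ 1 u → HasCompactSupport u →
      eLpNorm u p' (μ.restrict U) ≤ C * eLpNorm (fderiv ℝ u) p (μ.restrict U) := by
  by_cases hp'0 : p' = 0
  · exact ⟨0, fun u _ _ => by simp [hp'0]⟩
  set n := finrank ℝ E with hn_def
  let n' := NNReal.conjExponent n
  have h2p : (p : ℝ) < n := by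
    have : 0 < p⁻¹ - (n : ℝ)⁻¹ :=
      NNReal.coe_lt_coe.mpr (pos_iff_ne_zero.mpr (inv_ne_zero hp'0)) |>.trans_eq hp'
    rwa [NNReal.coe_inv, sub_pos,
      inv_lt_inv₀ _ (zero_lt_one.trans_le (NNReal.coe_le_coe.mpr hp))] at this
    exact_mod_cast hn
  have h0n : 2 ≤ n := Nat.succ_le_of_lt <| Nat.one_lt_cast.mp <| hp.trans_lt h2p
  have hn : NNReal.HolderConjugate n n' := .conjExponent (by norm_cast)
  have h2n : (0 : ℝ) < n - 1 := by simp_rw [sub_pos]; exact hn.coe.lt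
  have hnp : (0 : ℝ) < n - p := by simp_rw [sub_pos]; exact h2p
  have hn'0 : (n' : ℝ) ≠ 0 := hn.coe.symm.ne_zero
  have hn'pos : (0 : ℝ) < n' := hn.coe.symm.pos
  -- the exponent `γ = p (n - 1) / (n - p) ≥ 1`
  let γ : ℝ≥0 := .mk (p * (n - 1) / (n - p)) (by positivity)
  have h0γ : (γ : ℝ) = p * (n - 1) / (n - p) := rfl
  have h1γ : 1 ≤ (γ : ℝ) := by
    rw [h0γ, le_div_iff₀ hnp, one_mul, mul_sub, mul_one, sub_le_sub_iff_right]
    calc (n : ℝ) = 1 * n := (one_mul _).symm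
      _ ≤ p * n := by gcongr; exact_mod_cast hp
  have h1γ' : 1 ≤ γ := by exact_mod_cast h1γ
  have h2γ : γ * n' = p' := by
    rw [← NNReal.coe_inj, ← inv_inj, hp', NNReal.coe_mul, h0γ, hn.coe.conjugate_eq]
    simp [field]
  have h4γ : (γ : ℝ) ≠ 0 := (zero_lt_one.trans_le h1γ).ne'
  -- the transfer constant and the final constant
  set K : ℝ≥0 := (addHaarScalarFactor μ ((volume : Measure (ι → ℝ)).map e.symm) *
      ‖(e.symm : (ι → ℝ) →L[ℝ] E)‖₊ ^ (n' : ℝ)) *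
      ((addHaarScalarFactor μ ((volume : Measure (ι → ℝ)).map e.symm)) ^ (n' : ℝ))⁻¹ with hK
  refine ⟨K ^ (n' : ℝ)⁻¹ * γ, fun u hu h2u => ?_⟩
  set ν := μ.restrict U with hν
  have h7u := hu.continuous
  have h8u := hu.continuous_fderiv one_ne_zero
  borelize F
  -- the estimate for `‖u‖ ^ γ` on `U`
  have haux : ∫⁻ x, (‖u x‖ₑ ^ (γ : ℝ)) ^ (n' : ℝ) ∂ν ≤
      K * (∫⁻ x, γ * ‖u x‖ₑ ^ ((γ : ℝ) - 1) * ‖fderiv ℝ u x‖ₑ ∂ν) ^ (n' : ℝ) :=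
    setLIntegral_rpow_pow_le_of_equiv μ e hUm hU hu h2u hn.coe h1γ'
  clear_value K
  -- finiteness of `‖u‖_{L^{p'}(ν)}`
  by_cases h3u : ∫⁻ x, ‖u x‖ₑ ^ (p' : ℝ) ∂ν = 0
  · rw [eLpNorm_nnreal_eq_lintegral hp'0, h3u, ENNReal.zero_rpow_of_pos] <;> positivity
  have h4u : ∫⁻ x, ‖u x‖ₑ ^ (p' : ℝ) ∂ν ≠ ∞ := by
    refine lintegral_rpow_enorm_lt_top_of_eLpNorm'_lt_top
      ((NNReal.coe_pos.trans pos_iff_ne_zero).mpr hp'0) ?_ |>.ne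
    rw [← eLpNorm_nnreal_eq_eLpNorm' hp'0]
    exact ((hu.continuous.memLp_of_hasCompactSupport (μ := μ) h2u).restrict U).eLpNorm_lt_top
  -- `(∫ ‖u‖^{p'})^{1/n'} ≤ K^{1/n'} γ ∫ ‖u‖^{γ-1} ‖Du‖`
  have hstep : (∫⁻ x, ‖u x‖ₑ ^ (p' : ℝ) ∂ν) ^ (1 / (n' : ℝ)) ≤
      (K : ℝ≥0∞) ^ (n' : ℝ)⁻¹ * γ * ∫⁻ x, ‖u x‖ₑ ^ ((γ : ℝ) - 1) * ‖fderiv ℝ u x‖ₑ ∂ν :=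
    calc (∫⁻ x, ‖u x‖ₑ ^ (p' : ℝ) ∂ν) ^ (1 / (n' : ℝ))
        = (∫⁻ x, (‖u x‖ₑ ^ (γ : ℝ)) ^ (n' : ℝ) ∂ν) ^ (1 / (n' : ℝ)) := by
          congr! 3 with x
          rw [← ENNReal.rpow_mul, ← NNReal.coe_mul, h2γ]
      _ ≤ (K * (∫⁻ x, γ * ‖u x‖ₑ ^ ((γ : ℝ) - 1) * ‖fderiv ℝ u x‖ₑ ∂ν) ^ (n' : ℝ)) ^
            (1 / (n' : ℝ)) := by
          gcongr
      _ = (K : ℝ≥0∞) ^ (n' : ℝ)⁻¹ * ∫⁻ x, γ * (‖u x‖ₑ ^ ((γ : ℝ) - 1) * ‖fderiv ℝ u x‖ₑ) ∂ν := by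
          rw [ENNReal.mul_rpow_of_nonneg _ _ (by positivity), one_div,
            ENNReal.rpow_rpow_inv hn'0]
          simp_rw [mul_assoc]
      _ = (K : ℝ≥0∞) ^ (n' : ℝ)⁻¹ * γ * ∫⁻ x, ‖u x‖ₑ ^ ((γ : ℝ) - 1) * ‖fderiv ℝ u x‖ₑ ∂ν := by
          rw [lintegral_const_mul' _ _ ENNReal.coe_ne_top, mul_assoc]
  rcases hp.eq_or_lt with rfl | hp1
  · -- the case `p = 1`: `γ = 1`, `p' = n'`, no Hölder step
    have hγ1 : (γ : ℝ) = 1 := by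
      rw [h0γ, NNReal.coe_one, one_mul]
      exact div_self h2n.ne'
    have hp'n : (1 / (p' : ℝ)) = 1 / (n' : ℝ) := by
      have := congrArg NNReal.toReal h2γ
      rw [NNReal.coe_mul, hγ1, one_mul] at this
      rw [this]
    calc eLpNorm u p' ν = (∫⁻ x, ‖u x‖ₑ ^ (p' : ℝ) ∂ν) ^ (1 / (p' : ℝ)) :=
          eLpNorm_nnreal_eq_lintegral hp'0
      _ ≤ (K : ℝ≥0∞) ^ (n' : ℝ)⁻¹ * γ * ∫⁻ x, ‖u x‖ₑ ^ ((γ : ℝ) - 1) * ‖fderiv ℝ u x‖ₑ ∂ν := by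
          rw [hp'n]; exact hstep
      _ = (K : ℝ≥0∞) ^ (n' : ℝ)⁻¹ * γ * ∫⁻ x, ‖fderiv ℝ u x‖ₑ ∂ν := by
          simp [hγ1]
      _ = ((K ^ (n' : ℝ)⁻¹ * γ : ℝ≥0) : ℝ≥0∞) * eLpNorm (fderiv ℝ u) ((1 : ℝ≥0) : ℝ≥0∞) ν := by
          rw [ENNReal.coe_mul, ENNReal.coe_rpow_of_nonneg _ (inv_nonneg.2 n'.coe_nonneg),
            ENNReal.coe_one, eLpNorm_one_eq_lintegral_enorm]
  -- the case `p > 1`: Hölder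
  let q := Real.conjExponent p
  have hq : Real.HolderConjugate p q := .conjExponent hp1
  have h0p : p ≠ 0 := zero_lt_one.trans hp1 |>.ne'
  have h1p : (p : ℝ) ≠ 1 := hq.lt.ne'
  have h3p : (p : ℝ) - 1 ≠ 0 := sub_ne_zero_of_ne h1p
  have h2q : 1 / n' - 1 / q = 1 / p' := by
    simp_rw -zeta [one_div, hp']
    rw [← hq.one_sub_inv, ← hn.coe.one_sub_inv, sub_sub_sub_cancel_left]
    simp only [NNReal.coe_natCast, NNReal.coe_inv]
  have h3γ : ((γ : ℝ) - 1) * q = p' := by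
    rw [← inv_inj, hp', h0γ, hq.conjugate_eq]
    have : (p : ℝ) * (n - 1) - (n - p) = n * (p - 1) := by ring
    simp [field, this]
  have h5u : (∫⁻ x, ‖u x‖ₑ ^ (p' : ℝ) ∂ν) ^ (1 / q) ≠ 0 :=
    ENNReal.rpow_pos (pos_iff_ne_zero.mpr h3u) h4u |>.ne'
  have h6u : (∫⁻ x, ‖u x‖ₑ ^ (p' : ℝ) ∂ν) ^ (1 / q) ≠ ∞ := by finiteness
  have :=
  calc (∫⁻ x, ‖u x‖ₑ ^ (p' : ℝ) ∂ν) ^ (1 / (n' : ℝ))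
      ≤ (K : ℝ≥0∞) ^ (n' : ℝ)⁻¹ * γ * ∫⁻ x, ‖u x‖ₑ ^ ((γ : ℝ) - 1) * ‖fderiv ℝ u x‖ₑ ∂ν := hstep
    _ ≤ (K : ℝ≥0∞) ^ (n' : ℝ)⁻¹ * γ * ((∫⁻ x, ‖u x‖ₑ ^ (p' : ℝ) ∂ν) ^ (1 / q) *
        (∫⁻ x, ‖fderiv ℝ u x‖ₑ ^ (p : ℝ) ∂ν) ^ (1 / (p : ℝ))) := by
        gcongr
        convert!
          ENNReal.lintegral_mul_le_Lp_mul_Lq ν (.symm <| .conjExponent <| show 1 < (p : ℝ) from hp1)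
            ?_ ?_ using 5
        · simp [γ, n, q, ← ENNReal.rpow_mul, ← h3γ]
        · fun_prop
        · fun_prop
    _ = (K : ℝ≥0∞) ^ (n' : ℝ)⁻¹ * γ * (∫⁻ x, ‖fderiv ℝ u x‖ₑ ^ (p : ℝ) ∂ν) ^ (1 / (p : ℝ)) *
      (∫⁻ x, ‖u x‖ₑ ^ (p' : ℝ) ∂ν) ^ (1 / q) := by ring
  calc
    eLpNorm u p' ν
      = (∫⁻ x, ‖u x‖ₑ ^ (p' : ℝ) ∂ν) ^ (1 / (p' : ℝ)) := eLpNorm_nnreal_eq_lintegral hp'0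
    _ ≤ (K : ℝ≥0∞) ^ (n' : ℝ)⁻¹ * γ * (∫⁻ x, ‖fderiv ℝ u x‖ₑ ^ (p : ℝ) ∂ν) ^ (1 / (p : ℝ)) := by
      rwa [← h2q, ENNReal.rpow_sub _ _ h3u h4u, ENNReal.div_le_iff h5u h6u]
    _ = ((K ^ (n' : ℝ)⁻¹ * γ : ℝ≥0) : ℝ≥0∞) * eLpNorm (fderiv ℝ u) (↑p) ν := by
      rw [eLpNorm_nnreal_eq_lintegral h0p, ENNReal.coe_mul,
        ENNReal.coe_rpow_of_nonneg _ (inv_nonneg.2 n'.coe_nonneg)]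

end Literature.Analysis.FunctionSpaces
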